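import Mathlib.Analysis.SpecialFunctions.Pow.Real
import Mathlib.Analysis.SpecialFunctions.Log.Basic
import Mathlib.Analysis.SpecificLimits.Basic
import Mathlib.Topology.Algebra.InfiniteSum.Real
import HarnessLib

/-!
# Aspect-ratio bootstrap, part 1: spectral bookkeeping for ONE box (abstract, elementary)

Line `aspect-bootstrap` on crux `BalabanLadder.IR` (stmt-QuantumFields-19354, rung R2c; cell ym-ir, seat ym-ir-idea-6 g2,
LINE 3; skeleton `Cruxes/IR/Lines/aspect_bootstrap.lean` §1–§1b, landed verbatim as a helper `--supports` the crux).

HONEST FRAMING.  Nothing here proves the Yang–Mills mass gap (Clay), the lattice gap, or `BalabanLadder.IR`; R4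
(`BalabanUVStability4`) closes only the conditional finite-𝕋⁴ rung `BalabanLadder.UV`.  This file is pure real analysis
about ONE sequence `z : ℕ → ℝ` carrying a **spectral datum** (`HasSpectralDatum z`: `z (m+2) = Σᵢ λᵢ^{m+2}` with
`0 ≤ λᵢ ≤ λ_{i₀}`, `0 < λ_{i₀}` — exactly the shape of the tree's cubic trace formula
`Literature.MathematicalPhysics.QuantumFieldTheory.exists_spectralData_wilsonFinTorusPartition`).  It is the one-box input
of the abstract bootstrap `defectSquaring` (companion file `BalabanLadderIRDefectSquaring.lean`), which discharges the load
`R = ColdPurityBridge.ColdDoublingRecursionSC` of lines `floor-handshake` / `doubling-bridge` modulo typing infrastructure.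

CONTENTS (all PROVED, no physics): `phi z = lim log z(m)/m = log λ_{i₀}` (`phi_eq_log`); the thermal trace excess
`exc z m = z m / e^{m φ} − 1 = Σ_{i ≠ i₀} (λᵢ/λ_{i₀})^m ≥ 0`, non-increasing, with the time-doubling SQUARING
`exc z (2(m+2)) ≤ exc z (m+2)²` (`exc_two_mul_le_sq`); `Yfun z m = log z m − m φ = log (1 + exc z m)`; the ℓᵖ-monotonicity
of the spectrum `z(n')^n ≤ z(n)^{n'}` (`pow_le_pow_of_le`, `mul_log_le`), `z(2n) ≤ z(n)²`; the period-doubling defect of one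
box versus the excess (`defect_facts`: `0 ≤ δ ≤ 1`, `δ ≤ 2x`, `δ ≤ η ≤ 1/2 ⇒ x ≤ 2η`); a volume lower bound forces `φ ≥ −c`
(`phi_ge_of_lower`); the termwise Casimir inequality in the transposed channel (`termwise`).

References (for the physics these numbers book-keep): M. Lüscher, Commun. Math. Phys. 54 (1977) 283 (transfer matrix);
I. Montvay, G. Münster, *Quantum Fields on a Lattice* (1994) §3.2.6 (3.145) `Z = Tr 𝕋ⁿ`.
-/

noncomputable section

open scoped BigOperators Topology
open Filter

namespace Summit.QuantumFields.YangMills.Cruxes.IR.AspectBootstrap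
/-! ## §1 The abstract setting: axis-symmetric trace-positive partition families -/

/-- [TM] A **spectral datum** for a sequence `z : ℕ → ℝ` (`z τ = Tr 𝕋^τ`, `τ ≥ 2`): non-negative eigenvalues
`λᵢ ≤ λ_{i₀}`, `λ_{i₀} > 0`, with `Σᵢ λᵢ^{m+2} = z (m+2)` for every `m` (Hilbert–Schmidt positive transfer matrix; exactly
the shape of the tree's CUBIC `exists_spectralData_wilsonFinTorusPartition`). -/
def HasSpectralDatum (z : ℕ → ℝ) : Prop :=
  ∃ (ι : Type) (lam : ι → ℝ) (i₀ : ι), (∀ i, 0 ≤ lam i ∧ lam i ≤ lam i₀) ∧ 0 < lam i₀ ∧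
    ∀ m : ℕ, HasSum (fun i => lam i ^ (m + 2)) (z (m + 2))

/-! ## §1b Spectral bookkeeping for ONE box (abstract, elementary) -/

section OneBox

variable {z : ℕ → ℝ}

/-- `φ(z) := lim_m log z(m)/m` — the logarithm of the top eigenvalue (`phi_eq_log`). -/
def phi (z : ℕ → ℝ) : ℝ := limUnder atTop fun m : ℕ => Real.log (z (m + 2)) / ((m : ℝ) + 2)

/-- The thermal trace excess `x_m(z) := z(m)/e^{m φ(z)} − 1 = Σ_{i ≠ i₀} (λᵢ/λ_{i₀})^m`. -/
def exc (z : ℕ → ℝ) (m : ℕ) : ℝ := z m / Real.exp ((m : ℝ) * phi z) - 1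

/-- `Y_m(z) := log z(m) − m φ(z) = log (1 + x_m(z))`. -/
def Yfun (z : ℕ → ℝ) (m : ℕ) : ℝ := Real.log (z m) - (m : ℝ) * phi z

/-- The sandwich `λ₀^{m+2} ≤ z(m+2) ≤ λ₀^m z(2)` and `z > 0`, for a given datum. -/
theorem datum_bounds {ι : Type} {lam : ι → ℝ} {i₀ : ι} (hle : ∀ i, 0 ≤ lam i ∧ lam i ≤ lam i₀) (hpos : 0 < lam i₀)
    (hsum : ∀ m : ℕ, HasSum (fun i => lam i ^ (m + 2)) (z (m + 2))) (m : ℕ) :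
    lam i₀ ^ (m + 2) ≤ z (m + 2) ∧ z (m + 2) ≤ lam i₀ ^ m * z 2 ∧ 0 < z (m + 2) := by
  have h1 : lam i₀ ^ (m + 2) ≤ z (m + 2) :=
    le_hasSum (hsum m) i₀ fun j _ => pow_nonneg (hle j).1 _
  refine ⟨h1, ?_, lt_of_lt_of_le (pow_pos hpos _) h1⟩
  have h2 : HasSum (fun i => lam i₀ ^ m * lam i ^ (0 + 2)) (lam i₀ ^ m * z (0 + 2)) := (hsum 0).mul_left _
  simp only [Nat.zero_add] at h2
  refine hasSum_le (fun i => ?_) (hsum m) h2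
  rw [pow_add]
  exact mul_le_mul_of_nonneg_right (pow_le_pow_left₀ (hle i).1 (hle i).2 m) (pow_nonneg (hle i).1 2)

/-- `log z(m+2)/(m+2) → log λ₀`. -/
theorem tendsto_log_div {ι : Type} {lam : ι → ℝ} {i₀ : ι} (hle : ∀ i, 0 ≤ lam i ∧ lam i ≤ lam i₀) (hpos : 0 < lam i₀)
    (hsum : ∀ m : ℕ, HasSum (fun i => lam i ^ (m + 2)) (z (m + 2))) :
    Tendsto (fun m : ℕ => Real.log (z (m + 2)) / ((m : ℝ) + 2)) atTop (𝓝 (Real.log (lam i₀))) := by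
  set K : ℝ := Real.log (z 2) - 2 * Real.log (lam i₀) with hK
  have hz2 : 0 < z 2 := (datum_bounds hle hpos hsum 0).2.2
  have hup : Tendsto (fun m : ℕ => Real.log (lam i₀) + K / ((m : ℝ) + 2)) atTop (𝓝 (Real.log (lam i₀) + 0)) := by
    refine tendsto_const_nhds.add ?_
    refine Tendsto.div_atTop (tendsto_const_nhds) ?_
    exact tendsto_atTop_add_const_right _ _ tendsto_natCast_atTop_atTop
  rw [add_zero] at hup
  refine tendsto_of_tendsto_of_tendsto_of_le_of_le tendsto_const_nhds hup (fun m => ?_) (fun m => ?_)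
  · -- lower: (m+2) log λ₀ ≤ log z(m+2)
    obtain ⟨h1, -, hzpos⟩ := datum_bounds hle hpos hsum m
    have hm : (0 : ℝ) < (m : ℝ) + 2 := by positivity
    rw [le_div_iff₀ hm]
    have := Real.log_le_log (pow_pos hpos _) h1
    rw [Real.log_pow] at this
    push_cast at this
    linarith
  · obtain ⟨-, h2, hzpos⟩ := datum_bounds hle hpos hsum m
    have hm : (0 : ℝ) < (m : ℝ) + 2 := by positivity
    rw [div_le_iff₀ hm, add_mul, div_mul_cancel₀ _ hm.ne']
    have := Real.log_le_log hzpos h2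
    rw [Real.log_mul (pow_pos hpos _).ne' hz2.ne', Real.log_pow] at this
    rw [hK]
    linarith

/-- **`φ(z) = log λ₀`** for every spectral datum of `z`. -/
theorem phi_eq_log {ι : Type} {lam : ι → ℝ} {i₀ : ι} (hle : ∀ i, 0 ≤ lam i ∧ lam i ≤ lam i₀) (hpos : 0 < lam i₀)
    (hsum : ∀ m : ℕ, HasSum (fun i => lam i ^ (m + 2)) (z (m + 2))) : phi z = Real.log (lam i₀) :=
  (tendsto_log_div hle hpos hsum).limUnder_eq

/-- `e^{m φ(z)} = λ₀^m`. -/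
theorem exp_mul_phi {ι : Type} {lam : ι → ℝ} {i₀ : ι} (hle : ∀ i, 0 ≤ lam i ∧ lam i ≤ lam i₀) (hpos : 0 < lam i₀)
    (hsum : ∀ m : ℕ, HasSum (fun i => lam i ^ (m + 2)) (z (m + 2))) (m : ℕ) :
    Real.exp ((m : ℝ) * phi z) = lam i₀ ^ m := by
  rw [phi_eq_log hle hpos hsum, Real.exp_nat_mul, Real.exp_log hpos]

/-- **Ratios.**  `rᵢ = λᵢ/λ₀ ∈ [0,1]`, `r_{i₀} = 1`, `z > 0`, `Σ rᵢ^{m+2} = z(m+2)/e^{(m+2)φ}`, and the excess is the sum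
over `i ≠ i₀`. -/
theorem exists_ratios (h : HasSpectralDatum z) :
    ∃ (ι : Type) (_ : DecidableEq ι) (r : ι → ℝ) (i₀ : ι), (∀ i, 0 ≤ r i ∧ r i ≤ 1) ∧ r i₀ = 1 ∧
      (∀ m : ℕ, 0 < z (m + 2)) ∧
      (∀ m : ℕ, HasSum (fun i => r i ^ (m + 2)) (z (m + 2) / Real.exp (((m + 2 : ℕ) : ℝ) * phi z))) ∧
      ∀ m : ℕ, HasSum (Function.update (fun i => r i ^ (m + 2)) i₀ 0) (exc z (m + 2)) := by
  classical
  obtain ⟨ι, lam, i₀, hle, hpos, hsum⟩ := h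
  have hexp : ∀ m : ℕ, Real.exp (((m + 2 : ℕ) : ℝ) * phi z) = lam i₀ ^ (m + 2) := fun m =>
    exp_mul_phi hle hpos hsum (m + 2)
  refine ⟨ι, inferInstance, fun i => lam i / lam i₀, i₀, fun i => ⟨div_nonneg (hle i).1 hpos.le,
    (div_le_one hpos).2 (hle i).2⟩, div_self hpos.ne', fun m => (datum_bounds hle hpos hsum m).2.2,
    fun m => ?_, fun m => ?_⟩
  · rw [hexp]
    refine ((hsum m).div_const (lam i₀ ^ (m + 2))).congr_fun fun i => ?_
    rw [div_pow]
  · have h1 : HasSum (fun i => (lam i / lam i₀) ^ (m + 2)) (z (m + 2) / lam i₀ ^ (m + 2)) := by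
      refine ((hsum m).div_const (lam i₀ ^ (m + 2))).congr_fun fun i => ?_
      rw [div_pow]
    have h2 := h1.update i₀ 0
    rw [div_self hpos.ne', one_pow] at h2
    have hx : exc z (m + 2) = 0 - 1 + z (m + 2) / lam i₀ ^ (m + 2) := by
      unfold exc
      rw [hexp m]
      ring
    rw [hx]
    exact h2

/-- `x_{m+2} ≥ 0`. -/
theorem exc_nonneg (h : HasSpectralDatum z) (m : ℕ) : 0 ≤ exc z (m + 2) := by
  obtain ⟨ι, _, r, i₀, hr, -, -, -, hx⟩ := exists_ratios h
  refine (hx m).nonneg fun i => ?_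
  rcases eq_or_ne i i₀ with rfl | hne
  · simp
  · rw [Function.update_of_ne hne]; exact pow_nonneg (hr i).1 _

/-- `x` is non-increasing: `x_{k+2} ≤ x_{m+2}` for `m ≤ k`. -/
theorem exc_antitone (h : HasSpectralDatum z) {m k : ℕ} (hmk : m ≤ k) : exc z (k + 2) ≤ exc z (m + 2) := by
  obtain ⟨ι, _, r, i₀, hr, -, -, -, hx⟩ := exists_ratios h
  refine hasSum_le (fun i => ?_) (hx k) (hx m)
  rcases eq_or_ne i i₀ with rfl | hne
  · simp
  · rw [Function.update_of_ne hne, Function.update_of_ne hne]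
    exact pow_le_pow_of_le_one (hr i).1 (hr i).2 (by omega)

/-- `x_{2(m+2)} ≤ x_{m+2}²`. -/
theorem exc_two_mul_le_sq (h : HasSpectralDatum z) (m : ℕ) : exc z (2 * (m + 2)) ≤ exc z (m + 2) ^ 2 := by
  obtain ⟨ι, _, r, i₀, hr, -, -, -, hx⟩ := exists_ratios h
  have hxm := hx m
  have hx2 : HasSum (Function.update (fun i => r i ^ (2 * m + 2 + 2)) i₀ 0) (exc z (2 * (m + 2))) := by
    have := hx (2 * m + 2)
    rwa [show 2 * m + 2 + 2 = 2 * (m + 2) from by ring] at this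
  have hg0 : ∀ i, 0 ≤ Function.update (fun i => r i ^ (m + 2)) i₀ 0 i := fun i => by
    rcases eq_or_ne i i₀ with rfl | hne
    · simp
    · rw [Function.update_of_ne hne]; exact pow_nonneg (hr i).1 _
  have hterm : ∀ i, i ≠ i₀ → r i ^ (m + 2) ≤ exc z (m + 2) := fun i hne => by
    have := le_hasSum hxm i fun j _ => hg0 j
    rwa [Function.update_of_ne hne] at this
  have hcmp : ∀ i, Function.update (fun i => r i ^ (2 * m + 2 + 2)) i₀ 0 i ≤
      exc z (m + 2) * Function.update (fun i => r i ^ (m + 2)) i₀ 0 i := fun i => by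
    rcases eq_or_ne i i₀ with rfl | hne
    · simp
    · rw [Function.update_of_ne hne, Function.update_of_ne hne,
        show 2 * m + 2 + 2 = (m + 2) + (m + 2) from by ring, pow_add]
      exact mul_le_mul_of_nonneg_right (hterm i hne) (pow_nonneg (hr i).1 _)
  have := hasSum_le hcmp hx2 (hxm.mul_left (exc z (m + 2)))
  rw [sq]; exact this

/-- `z(m+2) = e^{(m+2)φ} (1 + x_{m+2})` (an identity, by the definition of `exc`). -/
theorem z_eq_exp_mul (z : ℕ → ℝ) (m : ℕ) :
    z (m + 2) = Real.exp (((m + 2 : ℕ) : ℝ) * phi z) * (1 + exc z (m + 2)) := by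
  unfold exc
  have hE : 0 < Real.exp (((m + 2 : ℕ) : ℝ) * phi z) := Real.exp_pos _
  field_simp
  push_cast
  ring

/-- `log z(m+2) = (m+2) φ + log(1 + x_{m+2})`, i.e. `Y_{m+2} = log(1 + x_{m+2})`. -/
theorem Yfun_eq_log (h : HasSpectralDatum z) (m : ℕ) : Yfun z (m + 2) = Real.log (1 + exc z (m + 2)) := by
  unfold Yfun
  have hx := exc_nonneg h m
  rw [z_eq_exp_mul z m, Real.log_mul (Real.exp_pos _).ne' (by linarith), Real.log_exp]
  push_cast
  ring

/-- `Y_{m+2} ≥ 0`. -/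
theorem Yfun_nonneg (h : HasSpectralDatum z) (m : ℕ) : 0 ≤ Yfun z (m + 2) := by
  rw [Yfun_eq_log h m]; exact Real.log_nonneg (by linarith [exc_nonneg h m])

/-- `Y` is non-increasing: `Y_{k+2} ≤ Y_{m+2}` for `m ≤ k`. -/
theorem Yfun_antitone (h : HasSpectralDatum z) {m k : ℕ} (hmk : m ≤ k) : Yfun z (k + 2) ≤ Yfun z (m + 2) := by
  rw [Yfun_eq_log h m, Yfun_eq_log h k]
  exact Real.log_le_log (by linarith [exc_nonneg h k]) (by linarith [exc_antitone h hmk])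

/-- `Y_{m+2} ≤ x_{m+2}` (`log (1+x) ≤ x`). -/
theorem Yfun_le_exc (h : HasSpectralDatum z) (m : ℕ) : Yfun z (m + 2) ≤ exc z (m + 2) := by
  rw [Yfun_eq_log h m]
  have hx := exc_nonneg h m
  have := Real.add_one_le_exp (Real.log (1 + exc z (m + 2)))
  rw [Real.exp_log (by linarith)] at this
  linarith

/-- `x_{m+2} = e^{Y_{m+2}} − 1`. -/
theorem exc_eq_exp_Yfun (h : HasSpectralDatum z) (m : ℕ) : exc z (m + 2) = Real.exp (Yfun z (m + 2)) - 1 := by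
  rw [Yfun_eq_log h m, Real.exp_log (by linarith [exc_nonneg h m])]; ring

/-- sandwich, lower half: `(m+2) φ ≤ log z(m+2)`. -/
theorem mul_phi_le_log (h : HasSpectralDatum z) (m : ℕ) : ((m + 2 : ℕ) : ℝ) * phi z ≤ Real.log (z (m + 2)) := by
  have := Yfun_nonneg h m
  unfold Yfun at this
  linarith

/-- sandwich, upper half: `log z(m+2) ≤ (m+2) φ + Y_2`. -/
theorem log_le_mul_phi_add (h : HasSpectralDatum z) (m : ℕ) :
    Real.log (z (m + 2)) ≤ ((m + 2 : ℕ) : ℝ) * phi z + Yfun z 2 := by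
  have := Yfun_antitone h (Nat.zero_le m)
  unfold Yfun at this ⊢
  push_cast at this ⊢
  linarith

/-- `z(m+2) > 0`. -/
theorem z_pos (h : HasSpectralDatum z) (m : ℕ) : 0 < z (m + 2) := by
  obtain ⟨ι, _, r, i₀, -, -, hz, -, -⟩ := exists_ratios h
  exact hz m

/-- **ℓᵖ-monotonicity of the spectrum**: `z(n')^n ≤ z(n)^{n'}` for `2 ≤ n ≤ n'` (i.e. `‖λ‖_{n'} ≤ ‖λ‖_n`). -/
theorem pow_le_pow_of_le (h : HasSpectralDatum z) {a a' : ℕ} (haa' : a ≤ a') :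
    z (a' + 2) ^ (a + 2) ≤ z (a + 2) ^ (a' + 2) := by
  obtain ⟨ι, lam, i₀, hle, hpos, hsum⟩ := h
  set S : ℝ := z (a + 2) with hS
  have hSpos : 0 < S := (datum_bounds hle hpos hsum a).2.2
  set ν : ℝ := S ^ (((a + 2 : ℕ) : ℝ)⁻¹) with hν
  have hνpos : 0 < ν := Real.rpow_pos_of_pos hSpos _
  have hνpow : ν ^ (a + 2) = S := by
    rw [hν]
    exact Real.rpow_inv_natCast_pow hSpos.le (by omega)
  have hli : ∀ i, lam i ≤ ν := fun i => by
    have h1 : lam i ^ (a + 2) ≤ S := le_hasSum (hsum a) i fun j _ => pow_nonneg (hle j).1 _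
    rw [← hνpow] at h1
    exact (pow_le_pow_iff_left₀ (hle i).1 hνpos.le (by omega)).1 h1
  have hcmp : ∀ i, lam i ^ (a' + 2) ≤ ν ^ (a' - a) * lam i ^ (a + 2) := fun i => by
    rw [show a' + 2 = (a' - a) + (a + 2) from by omega, pow_add]
    exact mul_le_mul_of_nonneg_right (pow_le_pow_left₀ (hle i).1 (hli i) _) (pow_nonneg (hle i).1 _)
  have hsum' : z (a' + 2) ≤ ν ^ (a' - a) * S := hasSum_le hcmp (hsum a') ((hsum a).mul_left _)
  have hz' : 0 ≤ z (a' + 2) := (datum_bounds hle hpos hsum a').2.2.le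
  calc z (a' + 2) ^ (a + 2) ≤ (ν ^ (a' - a) * S) ^ (a + 2) := pow_le_pow_left₀ hz' hsum' _
    _ = (ν ^ (a + 2)) ^ (a' + 2) := by
        rw [← hνpow, ← pow_add, ← pow_mul, ← pow_mul]; congr 1
        rw [show a' - a + (a + 2) = a' + 2 from by omega, mul_comm]
    _ = S ^ (a' + 2) := by rw [hνpow]

/-- log form: `n log z(n') ≤ n' log z(n)` for `2 ≤ n ≤ n'`. -/
theorem mul_log_le (h : HasSpectralDatum z) {a a' : ℕ} (haa' : a ≤ a') :
    ((a + 2 : ℕ) : ℝ) * Real.log (z (a' + 2)) ≤ ((a' + 2 : ℕ) : ℝ) * Real.log (z (a + 2)) := by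
  have h1 := Real.log_le_log (pow_pos (z_pos h a') _) (pow_le_pow_of_le h haa')
  rwa [Real.log_pow, Real.log_pow] at h1

/-- doubling: `z(2n) ≤ z(n)²`, `n ≥ 2`. -/
theorem z_two_mul_le_sq (h : HasSpectralDatum z) (m : ℕ) : z (2 * (m + 2)) ≤ z (m + 2) ^ 2 := by
  have h1 := pow_le_pow_of_le h (show m ≤ 2 * m + 2 by omega)
  rw [show 2 * m + 2 + 2 = 2 * (m + 2) from by ring] at h1
  rw [show z (m + 2) ^ (2 * (m + 2)) = (z (m + 2) ^ 2) ^ (m + 2) from by rw [← pow_mul]] at h1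
  have hz : 0 ≤ z (2 * (m + 2)) := by
    rw [show 2 * (m + 2) = (2 * m + 2) + 2 from by ring]; exact (z_pos h _).le
  exact (pow_le_pow_iff_left₀ hz (sq_nonneg _) (by omega : m + 2 ≠ 0)).1 h1

/-- The period-doubling defect of one box in terms of the excess: `0 ≤ δ ≤ 1`, `δ ≤ 2 x_t`, and
`δ ≤ η ≤ 1/2 ⇒ x_t ≤ 2η`. -/
theorem defect_facts (h : HasSpectralDatum z) (m : ℕ) :
    0 ≤ 1 - z (2 * (m + 2)) / z (m + 2) ^ 2 ∧ 1 - z (2 * (m + 2)) / z (m + 2) ^ 2 ≤ 1 ∧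
      1 - z (2 * (m + 2)) / z (m + 2) ^ 2 ≤ 2 * exc z (m + 2) ∧
      ∀ η : ℝ, η ≤ 1 / 2 → 1 - z (2 * (m + 2)) / z (m + 2) ^ 2 ≤ η → exc z (m + 2) ≤ 2 * η := by
  have hz1 : 0 < z (m + 2) := z_pos h m
  have hz2 : 0 < z (2 * (m + 2)) := by
    rw [show 2 * (m + 2) = (2 * m + 2) + 2 from by ring]; exact z_pos h _
  have hx1 := exc_nonneg h m
  have hx2 : 0 ≤ exc z (2 * (m + 2)) := by
    rw [show 2 * (m + 2) = (2 * m + 2) + 2 from by ring]; exact exc_nonneg h _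
  have hx21 : exc z (2 * (m + 2)) ≤ exc z (m + 2) := by
    rw [show 2 * (m + 2) = (2 * m + 2) + 2 from by ring]; exact exc_antitone h (by omega)
  -- the ratio in terms of the excess
  have e1 := z_eq_exp_mul z m
  have e2 : z (2 * (m + 2)) = Real.exp (((2 * (m + 2) : ℕ) : ℝ) * phi z) * (1 + exc z (2 * (m + 2))) := by
    have := z_eq_exp_mul z (2 * m + 2)
    rwa [show 2 * m + 2 + 2 = 2 * (m + 2) from by ring] at this
  have e3 : Real.exp (((2 * (m + 2) : ℕ) : ℝ) * phi z) = Real.exp (((m + 2 : ℕ) : ℝ) * phi z) ^ 2 := by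
    rw [← Real.exp_nat_mul]; push_cast; ring_nf
  have hE : 0 < Real.exp (((m + 2 : ℕ) : ℝ) * phi z) := Real.exp_pos _
  set x : ℝ := exc z (m + 2) with hxdef
  set x2 : ℝ := exc z (2 * (m + 2)) with hx2def
  have hx0 : (1 + x) ≠ 0 := ne_of_gt (by linarith)
  have hratio : z (2 * (m + 2)) / z (m + 2) ^ 2 = (1 + x2) / (1 + x) ^ 2 := by
    rw [e2, e3, e1]
    field_simp
  refine ⟨?_, ?_, ?_, fun η hη hδ => ?_⟩
  · rw [sub_nonneg, div_le_one (pow_pos hz1 2)]; exact z_two_mul_le_sq h m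
  · have : 0 ≤ z (2 * (m + 2)) / z (m + 2) ^ 2 := div_nonneg hz2.le (sq_nonneg _)
    linarith
  · rw [hratio]
    have h1 : 1 / (1 + x) ^ 2 ≤ (1 + x2) / (1 + x) ^ 2 :=
      div_le_div_of_nonneg_right (by linarith) (sq_nonneg _)
    have h2 : 1 - 2 * x ≤ 1 / (1 + x) ^ 2 := by
      rw [le_div_iff₀ (by positivity)]
      nlinarith [mul_nonneg hx1 hx1, mul_nonneg (mul_nonneg hx1 hx1) hx1]
    linarith
  · rw [hratio] at hδ
    have h1 : (1 + x2) / (1 + x) ^ 2 ≤ (1 + x) / (1 + x) ^ 2 :=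
      div_le_div_of_nonneg_right (by linarith) (sq_nonneg _)
    have h2 : (1 + x) / (1 + x) ^ 2 = 1 / (1 + x) := by
      field_simp
    rw [h2] at h1
    have h3 : 1 - η ≤ 1 / (1 + x) := by linarith
    rw [le_div_iff₀ (by positivity)] at h3
    nlinarith


/-- a lower volume bound on `log z` forces `φ ≥ −c`. -/
theorem phi_ge_of_lower (h : HasSpectralDatum z) (c : ℝ)
    (hlow : ∀ m : ℕ, -(c * ((m + 2 : ℕ) : ℝ)) ≤ Real.log (z (m + 2))) : -c ≤ phi z := by
  have hK := Yfun_nonneg h 0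
  have key : ∀ m : ℕ, -c ≤ phi z + Yfun z 2 / ((m : ℝ) + 2) := fun m => by
    have h1 := log_le_mul_phi_add h m
    have h2 := hlow m
    have hm : (0:ℝ) < (m:ℝ) + 2 := by positivity
    have e : ((m + 2 : ℕ) : ℝ) = (m : ℝ) + 2 := by push_cast; ring
    rw [e] at h1 h2
    rw [show phi z + Yfun z 2 / ((m:ℝ) + 2) = (phi z * ((m:ℝ) + 2) + Yfun z 2) / ((m:ℝ) + 2) from by
      field_simp, le_div_iff₀ hm]
    linarith
  have hlim : Tendsto (fun m : ℕ => phi z + Yfun z 2 / ((m : ℝ) + 2)) atTop (𝓝 (phi z + 0)) :=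
    tendsto_const_nhds.add (Tendsto.div_atTop tendsto_const_nhds
      (tendsto_atTop_add_const_right _ _ tendsto_natCast_atTop_atTop))
  rw [add_zero] at hlim
  exact le_of_tendsto_of_tendsto' tendsto_const_nhds hlim key

/-- termwise Casimir inequality in the transposed channel: `q log w(n) − log w(n') ≤ q Y_c(w)` for `c ≤ n`, `q n = n'`. -/
theorem termwise (h : HasSpectralDatum z) {kc kn kn' : ℕ} (hck : kc ≤ kn) (q : ℝ) (hq : 0 ≤ q)
    (hqn : q * ((kn + 2 : ℕ) : ℝ) = ((kn' + 2 : ℕ) : ℝ)) :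
    q * Real.log (z (kn + 2)) - Real.log (z (kn' + 2)) ≤ q * Yfun z (kc + 2) := by
  have e : Real.log (z (kn + 2)) = ((kn + 2 : ℕ) : ℝ) * phi z + Yfun z (kn + 2) := by unfold Yfun; ring
  have hY : q * Yfun z (kn + 2) ≤ q * Yfun z (kc + 2) := mul_le_mul_of_nonneg_left (Yfun_antitone h hck) hq
  have low := mul_phi_le_log h kn'
  have h1 : q * Real.log (z (kn + 2)) = q * ((kn + 2 : ℕ) : ℝ) * phi z + q * Yfun z (kn + 2) := by
    rw [e]; ring
  rw [hqn] at h1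
  linarith

end OneBox

end Summit.QuantumFields.YangMills.Cruxes.IR.AspectBootstrap

end
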